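import Mathlib
import Summits.Ventures.PercRepro.PuncturedLYMUnif67Table
import Summits.Ventures.PercRepro.PuncturedLYMUnif67PosDen1
import Summits.Ventures.PercRepro.PuncturedLYMUnif67PosCls1
import Summits.Ventures.PercRepro.PuncturedLYMUnif67PosCls2

/-!
# PercRepro — (SP) FOR ANY NUMBER OF PAIRWISE DISJOINT `6`-SETS AT LEVEL `7`: POSITIVITY OF THE TABLE
(p10, gen 41)

The positivity of the denominators `Qp`, `Pp` and of `Yc`, `Pc` for `n ≥ 8`, `6k ≤ n`; `sel_nonneg` (by the class guards) and `raw_nonneg`.  Nothing here asserts (SP).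
-/

namespace PercRepro.PuncturedLYM.Split.TypeLift.Unif67

/-- Every numerator of the table is nonnegative on its class. -/
theorem sel_nonneg (n k : ℚ) (c1 c2 c3 c4 c5 v : ℕ) (hn : 8 ≤ n) (hk1 : k = 0 ∨ 1 ≤ k) (hk : (c1 : ℚ) + c2 + c3 + c4 + c5 ≤ k)
    (hf : (7 : ℚ) - c1 - 2 * c2 - 3 * c3 - 4 * c4 - 5 * c5 ≤ n - 6 * k) : 0 ≤ sel c1 c2 c3 c4 c5 v n k := by
  unfold sel
  by_cases g1 : c1 = 0 ∧ c2 = 0 ∧ c3 = 0 ∧ c4 = 0 ∧ c5 = 0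
  · rw [if_pos g1]
    obtain ⟨rfl, rfl, rfl, rfl, rfl⟩ := g1
    exact sel_00000_nonneg n k v hn hk1 (by push_cast at hk; linarith) (by push_cast at hf; linarith)
  rw [if_neg g1]
  by_cases g2 : c1 = 1 ∧ c2 = 0 ∧ c3 = 0 ∧ c4 = 0 ∧ c5 = 0
  · rw [if_pos g2]
    obtain ⟨rfl, rfl, rfl, rfl, rfl⟩ := g2
    exact sel_10000_nonneg n k v (by push_cast at hk; linarith) (by push_cast at hf; linarith)
  rw [if_neg g2]
  by_cases g3 : c1 = 0 ∧ c2 = 1 ∧ c3 = 0 ∧ c4 = 0 ∧ c5 = 0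
  · rw [if_pos g3]
    obtain ⟨rfl, rfl, rfl, rfl, rfl⟩ := g3
    exact sel_01000_nonneg n k v (by push_cast at hk; linarith) (by push_cast at hf; linarith)
  rw [if_neg g3]
  by_cases g4 : c1 = 2 ∧ c2 = 0 ∧ c3 = 0 ∧ c4 = 0 ∧ c5 = 0
  · rw [if_pos g4]
    obtain ⟨rfl, rfl, rfl, rfl, rfl⟩ := g4
    exact sel_20000_nonneg n k v (by push_cast at hk; linarith) (by push_cast at hf; linarith)
  rw [if_neg g4]
  by_cases g5 : c1 = 0 ∧ c2 = 0 ∧ c3 = 1 ∧ c4 = 0 ∧ c5 = 0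
  · rw [if_pos g5]
    obtain ⟨rfl, rfl, rfl, rfl, rfl⟩ := g5
    exact sel_00100_nonneg n k v (by push_cast at hk; linarith) (by push_cast at hf; linarith)
  rw [if_neg g5]
  by_cases g6 : c1 = 1 ∧ c2 = 1 ∧ c3 = 0 ∧ c4 = 0 ∧ c5 = 0
  · rw [if_pos g6]
    obtain ⟨rfl, rfl, rfl, rfl, rfl⟩ := g6
    exact sel_11000_nonneg n k v (by push_cast at hk; linarith) (by push_cast at hf; linarith)
  rw [if_neg g6]
  by_cases g7 : c1 = 3 ∧ c2 = 0 ∧ c3 = 0 ∧ c4 = 0 ∧ c5 = 0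
  · rw [if_pos g7]
    obtain ⟨rfl, rfl, rfl, rfl, rfl⟩ := g7
    exact sel_30000_nonneg n k v (by push_cast at hk; linarith) (by push_cast at hf; linarith)
  rw [if_neg g7]
  by_cases g8 : c1 = 0 ∧ c2 = 0 ∧ c3 = 0 ∧ c4 = 1 ∧ c5 = 0
  · rw [if_pos g8]
    obtain ⟨rfl, rfl, rfl, rfl, rfl⟩ := g8
    exact sel_00010_nonneg n k v (by push_cast at hk; linarith) (by push_cast at hf; linarith)
  rw [if_neg g8]
  by_cases g9 : c1 = 0 ∧ c2 = 2 ∧ c3 = 0 ∧ c4 = 0 ∧ c5 = 0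
  · rw [if_pos g9]
    obtain ⟨rfl, rfl, rfl, rfl, rfl⟩ := g9
    exact sel_02000_nonneg n k v (by push_cast at hk; linarith) (by push_cast at hf; linarith)
  rw [if_neg g9]
  by_cases g10 : c1 = 1 ∧ c2 = 0 ∧ c3 = 1 ∧ c4 = 0 ∧ c5 = 0
  · rw [if_pos g10]
    obtain ⟨rfl, rfl, rfl, rfl, rfl⟩ := g10
    exact sel_10100_nonneg n k v (by push_cast at hk; linarith) (by push_cast at hf; linarith)
  rw [if_neg g10]
  by_cases g11 : c1 = 2 ∧ c2 = 1 ∧ c3 = 0 ∧ c4 = 0 ∧ c5 = 0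
  · rw [if_pos g11]
    obtain ⟨rfl, rfl, rfl, rfl, rfl⟩ := g11
    exact sel_21000_nonneg n k v (by push_cast at hk; linarith) (by push_cast at hf; linarith)
  rw [if_neg g11]
  by_cases g12 : c1 = 4 ∧ c2 = 0 ∧ c3 = 0 ∧ c4 = 0 ∧ c5 = 0
  · rw [if_pos g12]
    obtain ⟨rfl, rfl, rfl, rfl, rfl⟩ := g12
    exact sel_40000_nonneg n k v (by push_cast at hk; linarith) (by push_cast at hf; linarith)
  rw [if_neg g12]
  by_cases g13 : c1 = 0 ∧ c2 = 0 ∧ c3 = 0 ∧ c4 = 0 ∧ c5 = 1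
  · rw [if_pos g13]
    obtain ⟨rfl, rfl, rfl, rfl, rfl⟩ := g13
    exact sel_00001_nonneg n k v (by push_cast at hk; linarith) (by push_cast at hf; linarith)
  rw [if_neg g13]
  by_cases g14 : c1 = 0 ∧ c2 = 1 ∧ c3 = 1 ∧ c4 = 0 ∧ c5 = 0
  · rw [if_pos g14]
    obtain ⟨rfl, rfl, rfl, rfl, rfl⟩ := g14
    exact sel_01100_nonneg n k v (by push_cast at hk; linarith) (by push_cast at hf; linarith)
  rw [if_neg g14]
  by_cases g15 : c1 = 1 ∧ c2 = 0 ∧ c3 = 0 ∧ c4 = 1 ∧ c5 = 0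
  · rw [if_pos g15]
    obtain ⟨rfl, rfl, rfl, rfl, rfl⟩ := g15
    exact sel_10010_nonneg n k v (by push_cast at hk; linarith) (by push_cast at hf; linarith)
  rw [if_neg g15]
  by_cases g16 : c1 = 1 ∧ c2 = 2 ∧ c3 = 0 ∧ c4 = 0 ∧ c5 = 0
  · rw [if_pos g16]
    obtain ⟨rfl, rfl, rfl, rfl, rfl⟩ := g16
    exact sel_12000_nonneg n k v (by push_cast at hk; linarith) (by push_cast at hf; linarith)
  rw [if_neg g16]
  by_cases g17 : c1 = 2 ∧ c2 = 0 ∧ c3 = 1 ∧ c4 = 0 ∧ c5 = 0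
  · rw [if_pos g17]
    obtain ⟨rfl, rfl, rfl, rfl, rfl⟩ := g17
    exact sel_20100_nonneg n k v (by push_cast at hk; linarith) (by push_cast at hf; linarith)
  rw [if_neg g17]
  by_cases g18 : c1 = 3 ∧ c2 = 1 ∧ c3 = 0 ∧ c4 = 0 ∧ c5 = 0
  · rw [if_pos g18]
    obtain ⟨rfl, rfl, rfl, rfl, rfl⟩ := g18
    exact sel_31000_nonneg n k v (by push_cast at hk; linarith) (by push_cast at hf; linarith)
  rw [if_neg g18]
  by_cases g19 : c1 = 5 ∧ c2 = 0 ∧ c3 = 0 ∧ c4 = 0 ∧ c5 = 0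
  · rw [if_pos g19]
    obtain ⟨rfl, rfl, rfl, rfl, rfl⟩ := g19
    exact sel_50000_nonneg n k v (by push_cast at hk; linarith) (by push_cast at hf; linarith)
  rw [if_neg g19]
  by_cases g20 : c1 = 0 ∧ c2 = 0 ∧ c3 = 2 ∧ c4 = 0 ∧ c5 = 0
  · rw [if_pos g20]
    obtain ⟨rfl, rfl, rfl, rfl, rfl⟩ := g20
    exact sel_00200_nonneg n k v (by push_cast at hk; linarith) (by push_cast at hf; linarith)
  rw [if_neg g20]
  by_cases g21 : c1 = 0 ∧ c2 = 1 ∧ c3 = 0 ∧ c4 = 1 ∧ c5 = 0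
  · rw [if_pos g21]
    obtain ⟨rfl, rfl, rfl, rfl, rfl⟩ := g21
    exact sel_01010_nonneg n k v (by push_cast at hk; linarith) (by push_cast at hf; linarith)
  rw [if_neg g21]
  by_cases g22 : c1 = 0 ∧ c2 = 3 ∧ c3 = 0 ∧ c4 = 0 ∧ c5 = 0
  · rw [if_pos g22]
    obtain ⟨rfl, rfl, rfl, rfl, rfl⟩ := g22
    exact sel_03000_nonneg n k v (by push_cast at hk; linarith) (by push_cast at hf; linarith)
  rw [if_neg g22]
  by_cases g23 : c1 = 1 ∧ c2 = 0 ∧ c3 = 0 ∧ c4 = 0 ∧ c5 = 1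
  · rw [if_pos g23]
    obtain ⟨rfl, rfl, rfl, rfl, rfl⟩ := g23
    exact sel_10001_nonneg n k v (by push_cast at hk; linarith) (by push_cast at hf; linarith)
  rw [if_neg g23]
  by_cases g24 : c1 = 1 ∧ c2 = 1 ∧ c3 = 1 ∧ c4 = 0 ∧ c5 = 0
  · rw [if_pos g24]
    obtain ⟨rfl, rfl, rfl, rfl, rfl⟩ := g24
    exact sel_11100_nonneg n k v (by push_cast at hk; linarith) (by push_cast at hf; linarith)
  rw [if_neg g24]
  by_cases g25 : c1 = 2 ∧ c2 = 0 ∧ c3 = 0 ∧ c4 = 1 ∧ c5 = 0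
  · rw [if_pos g25]
    obtain ⟨rfl, rfl, rfl, rfl, rfl⟩ := g25
    exact sel_20010_nonneg n k v (by push_cast at hk; linarith) (by push_cast at hf; linarith)
  rw [if_neg g25]
  by_cases g26 : c1 = 2 ∧ c2 = 2 ∧ c3 = 0 ∧ c4 = 0 ∧ c5 = 0
  · rw [if_pos g26]
    obtain ⟨rfl, rfl, rfl, rfl, rfl⟩ := g26
    exact sel_22000_nonneg n k v (by push_cast at hk; linarith) (by push_cast at hf; linarith)
  rw [if_neg g26]
  by_cases g27 : c1 = 3 ∧ c2 = 0 ∧ c3 = 1 ∧ c4 = 0 ∧ c5 = 0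
  · rw [if_pos g27]
    obtain ⟨rfl, rfl, rfl, rfl, rfl⟩ := g27
    exact sel_30100_nonneg n k v (by push_cast at hk; linarith) (by push_cast at hf; linarith)
  rw [if_neg g27]
  by_cases g28 : c1 = 4 ∧ c2 = 1 ∧ c3 = 0 ∧ c4 = 0 ∧ c5 = 0
  · rw [if_pos g28]
    obtain ⟨rfl, rfl, rfl, rfl, rfl⟩ := g28
    exact sel_41000_nonneg n k v (by push_cast at hk; linarith) (by push_cast at hf; linarith)
  rw [if_neg g28]
  by_cases g29 : c1 = 6 ∧ c2 = 0 ∧ c3 = 0 ∧ c4 = 0 ∧ c5 = 0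
  · rw [if_pos g29]
    obtain ⟨rfl, rfl, rfl, rfl, rfl⟩ := g29
    exact sel_60000_nonneg n k v (by push_cast at hk; linarith) (by push_cast at hf; linarith)
  rw [if_neg g29]
  by_cases g30 : c1 = 0 ∧ c2 = 0 ∧ c3 = 1 ∧ c4 = 1 ∧ c5 = 0
  · rw [if_pos g30]
    obtain ⟨rfl, rfl, rfl, rfl, rfl⟩ := g30
    exact sel_00110_nonneg n k v (by push_cast at hk; linarith) (by push_cast at hf; linarith)
  rw [if_neg g30]
  by_cases g31 : c1 = 0 ∧ c2 = 1 ∧ c3 = 0 ∧ c4 = 0 ∧ c5 = 1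
  · rw [if_pos g31]
    obtain ⟨rfl, rfl, rfl, rfl, rfl⟩ := g31
    exact sel_01001_nonneg n k v (by push_cast at hk; linarith) (by push_cast at hf; linarith)
  rw [if_neg g31]
  by_cases g32 : c1 = 0 ∧ c2 = 2 ∧ c3 = 1 ∧ c4 = 0 ∧ c5 = 0
  · rw [if_pos g32]
    obtain ⟨rfl, rfl, rfl, rfl, rfl⟩ := g32
    exact sel_02100_nonneg n k v (by push_cast at hk; linarith) (by push_cast at hf; linarith)
  rw [if_neg g32]
  by_cases g33 : c1 = 1 ∧ c2 = 0 ∧ c3 = 2 ∧ c4 = 0 ∧ c5 = 0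
  · rw [if_pos g33]
    obtain ⟨rfl, rfl, rfl, rfl, rfl⟩ := g33
    exact sel_10200_nonneg n k v (by push_cast at hk; linarith) (by push_cast at hf; linarith)
  rw [if_neg g33]
  by_cases g34 : c1 = 1 ∧ c2 = 1 ∧ c3 = 0 ∧ c4 = 1 ∧ c5 = 0
  · rw [if_pos g34]
    obtain ⟨rfl, rfl, rfl, rfl, rfl⟩ := g34
    exact sel_11010_nonneg n k v (by push_cast at hk; linarith) (by push_cast at hf; linarith)
  rw [if_neg g34]
  by_cases g35 : c1 = 1 ∧ c2 = 3 ∧ c3 = 0 ∧ c4 = 0 ∧ c5 = 0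
  · rw [if_pos g35]
    obtain ⟨rfl, rfl, rfl, rfl, rfl⟩ := g35
    exact sel_13000_nonneg n k v (by push_cast at hk; linarith) (by push_cast at hf; linarith)
  rw [if_neg g35]
  by_cases g36 : c1 = 2 ∧ c2 = 0 ∧ c3 = 0 ∧ c4 = 0 ∧ c5 = 1
  · rw [if_pos g36]
    obtain ⟨rfl, rfl, rfl, rfl, rfl⟩ := g36
    exact sel_20001_nonneg n k v (by push_cast at hk; linarith) (by push_cast at hf; linarith)
  rw [if_neg g36]
  by_cases g37 : c1 = 2 ∧ c2 = 1 ∧ c3 = 1 ∧ c4 = 0 ∧ c5 = 0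
  · rw [if_pos g37]
    obtain ⟨rfl, rfl, rfl, rfl, rfl⟩ := g37
    exact sel_21100_nonneg n k v (by push_cast at hk; linarith) (by push_cast at hf; linarith)
  rw [if_neg g37]
  by_cases g38 : c1 = 3 ∧ c2 = 0 ∧ c3 = 0 ∧ c4 = 1 ∧ c5 = 0
  · rw [if_pos g38]
    obtain ⟨rfl, rfl, rfl, rfl, rfl⟩ := g38
    exact sel_30010_nonneg n k v (by push_cast at hk; linarith) (by push_cast at hf; linarith)
  rw [if_neg g38]
  by_cases g39 : c1 = 3 ∧ c2 = 2 ∧ c3 = 0 ∧ c4 = 0 ∧ c5 = 0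
  · rw [if_pos g39]
    obtain ⟨rfl, rfl, rfl, rfl, rfl⟩ := g39
    exact sel_32000_nonneg n k v (by push_cast at hk; linarith) (by push_cast at hf; linarith)
  rw [if_neg g39]
  by_cases g40 : c1 = 4 ∧ c2 = 0 ∧ c3 = 1 ∧ c4 = 0 ∧ c5 = 0
  · rw [if_pos g40]
    obtain ⟨rfl, rfl, rfl, rfl, rfl⟩ := g40
    exact sel_40100_nonneg n k v (by push_cast at hk; linarith) (by push_cast at hf; linarith)
  rw [if_neg g40]
  by_cases g41 : c1 = 5 ∧ c2 = 1 ∧ c3 = 0 ∧ c4 = 0 ∧ c5 = 0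
  · rw [if_pos g41]
    obtain ⟨rfl, rfl, rfl, rfl, rfl⟩ := g41
    exact sel_51000_nonneg n k v (by push_cast at hk; linarith) (by push_cast at hf; linarith)
  rw [if_neg g41]
  by_cases g42 : c1 = 7 ∧ c2 = 0 ∧ c3 = 0 ∧ c4 = 0 ∧ c5 = 0
  · rw [if_pos g42]
    obtain ⟨rfl, rfl, rfl, rfl, rfl⟩ := g42
    exact sel_70000_nonneg n k v (by push_cast at hk; linarith) (by push_cast at hf; linarith)
  rw [if_neg g42]

/-- The unnormalised weights are nonnegative on their classes. -/
theorem raw_nonneg (n k : ℚ) (c1 c2 c3 c4 c5 v : ℕ) (hn : 8 ≤ n) (hk3 : 6 * k ≤ n) (hk2 : k = 0 ∨ k = 1 ∨ 2 ≤ k)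
    (hk : (c1 : ℚ) + c2 + c3 + c4 + c5 ≤ k) (hf : (7 : ℚ) - c1 - 2 * c2 - 3 * c3 - 4 * c4 - 5 * c5 ≤ n - 6 * k) : 0 ≤ raw n k c1 c2 c3 c4 c5 v := by
  unfold raw
  have hk1 : k = 0 ∨ 1 ≤ k := by
    rcases hk2 with h | h | h
    · exact Or.inl h
    · exact Or.inr (by linarith)
    · exact Or.inr (by linarith)
  have hQ := Qp_pos n k hn hk2 hk3
  have hP := Pp_pos n k hn hk3
  exact div_nonneg (sel_nonneg n k c1 c2 c3 c4 c5 v hn hk1 hk hf) (by positivity)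

end PercRepro.PuncturedLYM.Split.TypeLift.Unif67
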